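import Mathlib

/-!
# PercRepro — THE VALUE-BLOCK PIPELINE AT (3,3): THE POLYNOMIALS OF THE β-TABLE AND THEIR POSITIVITY
(p10, gen 43)

`k` pairwise disjoint TRIPLES at level `3` on `n = 3k + f` points.  The value-block recursion of paper
proofs/P10-PEEL-g42.md §1b has three stages here: the cap-`2` stage (one removal probability `β₂(1) = B`), the cap-`1`
stage at level `3` reached by the class `0` (`β₁(1) = x₁`, `β₁(2) = x₂`, `β₁(3) = x₃`), and the cap-`1` stage at level `1`
reached by the class `1` (`β₁(1) = y₁`, written in the TOP count `K`, i.e. at its own count `K − 1`).  Each β is a reduced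
rational function of `(K, f)`: `#P = P33 = C(n,3) − K`, `#Y = Y33 = C(n,4)`, `cols1 = C(n−3, 2) − 3(K−1)` (the cap-`1`
columns at level `1` of the inner world), `B = Bnum / (72·P33·cols1)`, `1 − B = anum / (72·P33·cols1)`, `x₁ = x1num /
(24·P33)`, `x₂ = x2num / (72·P33·cols1)`, `x₃ = x3num / (48·P33·cols1)`, `y₁ = y1num / (2·anum)` (work/mining/sym33.py,
cross-checked against the direct solve of the leaf identities on 4,224 values).  This file holds the polynomials and
their positivity on the regions `K ≥ 1 ∧ f ≥ 2`, `K ≥ 2`, `K ≥ 2 ∧ f ≥ 1`, `K ≥ 3`: every coefficient is nonnegative after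
the shift (`ring_nf; positivity`).  Nothing here asserts (SP).
-/

namespace PercRepro.PuncturedLYM.Split.Peel.Cap33

/-- `n = 3K + f`. -/
def n33 (K f : ℚ) : ℚ := 3 * K + f
/-- `#P = C(n, 3) − K`: the punctured `3`-sets. -/
def P33 (K f : ℚ) : ℚ := n33 K f * (n33 K f - 1) * (n33 K f - 2) / 6 - K
/-- `#Y = C(n, 4)`. -/
def Y33 (K f : ℚ) : ℚ := n33 K f * (n33 K f - 1) * (n33 K f - 2) * (n33 K f - 3) / 24
/-- The cap-`1` columns at level `1` on `K − 1` members and `f` free points: `C(f,2) + 3(K−1)f + 9·C(K−1,2)`. -/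
def cols1 (K f : ℚ) : ℚ := f * (f - 1) / 2 + 3 * (K - 1) * f + 9 * (K - 1) * (K - 2) / 2
/-- The numerator of `β₂(1) = B`. -/
def Bnum (K f : ℚ) : ℚ :=
  729 * K ^ 5 + 1215 * K ^ 4 * f + 810 * K ^ 3 * f ^ 2 + 270 * K ^ 2 * f ^ 3 + 45 * K * f ^ 4 + 3 * f ^ 5
    - 2835 * K ^ 4 - 3618 * K ^ 3 * f - 1728 * K ^ 2 * f ^ 2 - 366 * K * f ^ 3 - 29 * f ^ 4
    + 3321 * K ^ 3 + 3267 * K ^ 2 * f + 1071 * K * f ^ 2 + 117 * f ^ 3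
    - 1053 * K ^ 2 - 966 * K * f - 193 * f ^ 2 - 162 * K + 102 * f
/-- The common denominator `72·#P·cols1` of `B`, `x₂` and `1 − B`. -/
def Bden (K f : ℚ) : ℚ := 72 * P33 K f * cols1 K f
/-- The numerator of `1 − B` (`= Bden − Bnum`). -/
def anum (K f : ℚ) : ℚ :=
  729 * K ^ 5 + 1215 * K ^ 4 * f + 810 * K ^ 3 * f ^ 2 + 270 * K ^ 2 * f ^ 3 + 45 * K * f ^ 4 + 3 * f ^ 5
    - 2997 * K ^ 4 - 3834 * K ^ 3 * f - 1836 * K ^ 2 * f ^ 2 - 390 * K * f ^ 3 - 31 * f ^ 4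
    + 3969 * K ^ 3 + 3807 * K ^ 2 * f + 1215 * K * f ^ 2 + 129 * f ^ 3
    - 1863 * K ^ 2 - 1302 * K * f - 215 * f ^ 2 + 162 * K + 114 * f
/-- The numerator of `β₁(1) = x₁` at the level-`3` cap-`1` stage. -/
def x1num (K f : ℚ) : ℚ :=
  27 * K ^ 3 + 27 * K ^ 2 * f + 9 * K * f ^ 2 + f ^ 3 - 27 * K ^ 2 - 18 * K * f - 3 * f ^ 2 + 6 * K + 4 * f - 6
/-- The denominator `24·#P` of `x₁`. -/
def x1den (K f : ℚ) : ℚ := 24 * P33 K f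
/-- The numerator of `β₁(2) = x₂` (denominator `Bden`). -/
def x2num (K f : ℚ) : ℚ :=
  729 * K ^ 5 + 1215 * K ^ 4 * f + 810 * K ^ 3 * f ^ 2 + 270 * K ^ 2 * f ^ 3 + 45 * K * f ^ 4 + 3 * f ^ 5
    - 2916 * K ^ 4 - 3726 * K ^ 3 * f - 1782 * K ^ 2 * f ^ 2 - 378 * K * f ^ 3 - 30 * f ^ 4
    + 3753 * K ^ 3 + 3645 * K ^ 2 * f + 1179 * K * f ^ 2 + 127 * f ^ 3
    - 1818 * K ^ 2 - 1350 * K * f - 236 * f ^ 2 + 324 * K + 192 * f - 72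
/-- The numerator of `β₁(3) = x₃`. -/
def x3num (K f : ℚ) : ℚ :=
  729 * K ^ 5 + 1215 * K ^ 4 * f + 810 * K ^ 3 * f ^ 2 + 270 * K ^ 2 * f ^ 3 + 45 * K * f ^ 4 + 3 * f ^ 5
    - 2916 * K ^ 4 - 3726 * K ^ 3 * f - 1782 * K ^ 2 * f ^ 2 - 378 * K * f ^ 3 - 30 * f ^ 4
    + 3699 * K ^ 3 + 3591 * K ^ 2 * f + 1161 * K * f ^ 2 + 125 * f ^ 3
    - 1602 * K ^ 2 - 1218 * K * f - 216 * f ^ 2 + 102 * K + 130 * f - 12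
/-- The denominator `48·#P·cols1` of `x₃`. -/
def x3den (K f : ℚ) : ℚ := 48 * P33 K f * cols1 K f
/-- The numerator of `β₁(1) = y₁` at the level-`1` cap-`1` stage (in the top count `K`). -/
def y1num (K f : ℚ) : ℚ :=
  729 * K ^ 5 + 1215 * K ^ 4 * f + 810 * K ^ 3 * f ^ 2 + 270 * K ^ 2 * f ^ 3 + 45 * K * f ^ 4 + 3 * f ^ 5
    - 2997 * K ^ 4 - 3834 * K ^ 3 * f - 1836 * K ^ 2 * f ^ 2 - 390 * K * f ^ 3 - 31 * f ^ 4
    + 4023 * K ^ 3 + 3861 * K ^ 2 * f + 1233 * K * f ^ 2 + 131 * f ^ 3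
    - 2025 * K ^ 2 - 1374 * K * f - 221 * f ^ 2 + 270 * K + 118 * f
/-- The denominator `2·anum` of `y₁`. -/
def y1den (K f : ℚ) : ℚ := 2 * anum K f

/-- `Bden − Bnum = anum`. -/
theorem Bden_sub_Bnum (K f : ℚ) : Bden K f - Bnum K f = anum K f := by
  simp only [Bden, Bnum, anum, P33, cols1, n33]; ring

/-- `x3den = (2/3)·Bden`. -/
theorem x3den_eq (K f : ℚ) : x3den K f = 2 / 3 * Bden K f := by
  simp only [x3den, Bden]; ring

/-! ### The denominators: `#P`, `Bden`, `anum` -/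

/-- `#P ≥ 0` for `K ≥ 1`. -/
theorem P33_nonneg {K f : ℕ} (hK : 1 ≤ K) : 0 ≤ P33 K f := by
  obtain ⟨k', rfl⟩ := Nat.exists_eq_add_of_le hK
  simp only [P33, n33]; push_cast; ring_nf; positivity

/-- `#P > 0` for `K ≥ 1`, `f ≥ 1`. -/
theorem P33_pos {K f : ℕ} (hK : 1 ≤ K) (hf : 1 ≤ f) : 0 < P33 K f := by
  obtain ⟨k', rfl⟩ := Nat.exists_eq_add_of_le hK
  obtain ⟨f', rfl⟩ := Nat.exists_eq_add_of_le hf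
  simp only [P33, n33]; push_cast; ring_nf; positivity

/-- `#P > 0` for `K ≥ 2`. -/
theorem P33_pos_two {K f : ℕ} (hK : 2 ≤ K) : 0 < P33 K f := by
  obtain ⟨k', rfl⟩ := Nat.exists_eq_add_of_le hK
  simp only [P33, n33]; push_cast; ring_nf; positivity

/-- `#P > 0` for `K = 0`, `f ≥ 3`. -/
theorem P33_pos_zero {f : ℕ} (hf : 3 ≤ f) : 0 < P33 0 f := by
  obtain ⟨f', rfl⟩ := Nat.exists_eq_add_of_le hf
  simp only [P33, n33]; push_cast; ring_nf; positivity

/-- `Bden > 0` for `K ≥ 1`, `f ≥ 2`. -/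
theorem Bden_pos_A {K f : ℕ} (hK : 1 ≤ K) (hf : 2 ≤ f) : 0 < Bden K f := by
  obtain ⟨k', rfl⟩ := Nat.exists_eq_add_of_le hK
  obtain ⟨f', rfl⟩ := Nat.exists_eq_add_of_le hf
  simp only [Bden, P33, cols1, n33]; push_cast; ring_nf; positivity

/-- `Bden ≥ 0` for `K ≥ 2`. -/
theorem Bden_nonneg_B {K f : ℕ} (hK : 2 ≤ K) : 0 ≤ Bden K f := by
  obtain ⟨k', rfl⟩ := Nat.exists_eq_add_of_le hK
  simp only [Bden, P33, cols1, n33]; push_cast; ring_nf; positivity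

/-- `Bden > 0` for `K ≥ 2`, `f ≥ 1`. -/
theorem Bden_pos_B {K f : ℕ} (hK : 2 ≤ K) (hf : 1 ≤ f) : 0 < Bden K f := by
  obtain ⟨k', rfl⟩ := Nat.exists_eq_add_of_le hK
  obtain ⟨f', rfl⟩ := Nat.exists_eq_add_of_le hf
  simp only [Bden, P33, cols1, n33]; push_cast; ring_nf; positivity

/-- `Bden > 0` for `K ≥ 3`. -/
theorem Bden_pos_C {K f : ℕ} (hK : 3 ≤ K) : 0 < Bden K f := by
  obtain ⟨k', rfl⟩ := Nat.exists_eq_add_of_le hK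
  simp only [Bden, P33, cols1, n33]; push_cast; ring_nf; positivity

/-- `anum ≥ 0` for `K ≥ 2`. -/
theorem anum_nonneg_B {K f : ℕ} (hK : 2 ≤ K) : 0 ≤ anum K f := by
  obtain ⟨k', rfl⟩ := Nat.exists_eq_add_of_le hK
  simp only [anum]; push_cast; ring_nf; positivity

/-- `anum > 0` for `K ≥ 2`, `f ≥ 1`. -/
theorem anum_pos_B {K f : ℕ} (hK : 2 ≤ K) (hf : 1 ≤ f) : 0 < anum K f := by
  obtain ⟨k', rfl⟩ := Nat.exists_eq_add_of_le hK
  obtain ⟨f', rfl⟩ := Nat.exists_eq_add_of_le hf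
  simp only [anum]; push_cast; ring_nf; positivity

/-- `anum > 0` for `K ≥ 3`. -/
theorem anum_pos_C {K f : ℕ} (hK : 3 ≤ K) : 0 < anum K f := by
  obtain ⟨k', rfl⟩ := Nat.exists_eq_add_of_le hK
  simp only [anum]; push_cast; ring_nf; positivity

/-! ### `B = β₂(1)` -/

/-- `Bnum ≥ 0` for `K ≥ 1`, `f ≥ 2`. -/
theorem Bnum_nonneg_A {K f : ℕ} (hK : 1 ≤ K) (hf : 2 ≤ f) : 0 ≤ Bnum K f := by
  obtain ⟨k', rfl⟩ := Nat.exists_eq_add_of_le hK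
  obtain ⟨f', rfl⟩ := Nat.exists_eq_add_of_le hf
  simp only [Bnum]; push_cast; ring_nf; positivity

/-- `Bnum ≥ 0` for `K ≥ 2`. -/
theorem Bnum_nonneg_B {K f : ℕ} (hK : 2 ≤ K) : 0 ≤ Bnum K f := by
  obtain ⟨k', rfl⟩ := Nat.exists_eq_add_of_le hK
  simp only [Bnum]; push_cast; ring_nf; positivity

/-- `Bnum ≤ Bden` for `K ≥ 1`, `f ≥ 2`. -/
theorem Bnum_le_Bden_A {K f : ℕ} (hK : 1 ≤ K) (hf : 2 ≤ f) : Bnum K f ≤ Bden K f := by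
  obtain ⟨k', rfl⟩ := Nat.exists_eq_add_of_le hK
  obtain ⟨f', rfl⟩ := Nat.exists_eq_add_of_le hf
  rw [← sub_nonneg]
  simp only [Bden, Bnum, P33, cols1, n33]; push_cast; ring_nf; positivity

/-- `Bnum ≤ Bden` for `K ≥ 2`. -/
theorem Bnum_le_Bden_B {K f : ℕ} (hK : 2 ≤ K) : Bnum K f ≤ Bden K f := by
  obtain ⟨k', rfl⟩ := Nat.exists_eq_add_of_le hK
  rw [← sub_nonneg]
  simp only [Bden, Bnum, P33, cols1, n33]; push_cast; ring_nf; positivity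

/-! ### `x₁ = β₁(1)` at level `3` -/

/-- `x1num ≥ 0` for `K ≥ 1`. -/
theorem x1num_nonneg {K f : ℕ} (hK : 1 ≤ K) : 0 ≤ x1num K f := by
  obtain ⟨k', rfl⟩ := Nat.exists_eq_add_of_le hK
  simp only [x1num]; push_cast; ring_nf; positivity

/-- `x1den ≥ 0` for `K ≥ 1`. -/
theorem x1den_nonneg {K f : ℕ} (hK : 1 ≤ K) : 0 ≤ x1den K f := by
  obtain ⟨k', rfl⟩ := Nat.exists_eq_add_of_le hK
  simp only [x1den, P33, n33]; push_cast; ring_nf; positivity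

/-- `x1num ≤ x1den` for `K ≥ 1`. -/
theorem x1num_le_x1den {K f : ℕ} (hK : 1 ≤ K) : x1num K f ≤ x1den K f := by
  obtain ⟨k', rfl⟩ := Nat.exists_eq_add_of_le hK
  rw [← sub_nonneg]
  simp only [x1den, x1num, P33, n33]; push_cast; ring_nf; positivity

/-! ### `x₂ = β₁(2)` at level `3` -/

/-- `x2num ≥ 0` for `K ≥ 1`, `f ≥ 2`. -/
theorem x2num_nonneg_A {K f : ℕ} (hK : 1 ≤ K) (hf : 2 ≤ f) : 0 ≤ x2num K f := by
  obtain ⟨k', rfl⟩ := Nat.exists_eq_add_of_le hK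
  obtain ⟨f', rfl⟩ := Nat.exists_eq_add_of_le hf
  simp only [x2num]; push_cast; ring_nf; positivity

/-- `x2num ≥ 0` for `K ≥ 2`. -/
theorem x2num_nonneg_B {K f : ℕ} (hK : 2 ≤ K) : 0 ≤ x2num K f := by
  obtain ⟨k', rfl⟩ := Nat.exists_eq_add_of_le hK
  simp only [x2num]; push_cast; ring_nf; positivity

/-- `x2num ≤ Bden` for `K ≥ 1`, `f ≥ 2`. -/
theorem x2num_le_Bden_A {K f : ℕ} (hK : 1 ≤ K) (hf : 2 ≤ f) : x2num K f ≤ Bden K f := by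
  obtain ⟨k', rfl⟩ := Nat.exists_eq_add_of_le hK
  obtain ⟨f', rfl⟩ := Nat.exists_eq_add_of_le hf
  rw [← sub_nonneg]
  simp only [Bden, x2num, P33, cols1, n33]; push_cast; ring_nf; positivity

/-- `x2num ≤ Bden` for `K ≥ 2`. -/
theorem x2num_le_Bden_B {K f : ℕ} (hK : 2 ≤ K) : x2num K f ≤ Bden K f := by
  obtain ⟨k', rfl⟩ := Nat.exists_eq_add_of_le hK
  rw [← sub_nonneg]
  simp only [Bden, x2num, P33, cols1, n33]; push_cast; ring_nf; positivity

/-! ### `x₃ = β₁(3)` at level `3` -/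

/-- `x3num ≥ 0` for `K ≥ 1`, `f ≥ 2`. -/
theorem x3num_nonneg_A {K f : ℕ} (hK : 1 ≤ K) (hf : 2 ≤ f) : 0 ≤ x3num K f := by
  obtain ⟨k', rfl⟩ := Nat.exists_eq_add_of_le hK
  obtain ⟨f', rfl⟩ := Nat.exists_eq_add_of_le hf
  simp only [x3num]; push_cast; ring_nf; positivity

/-- `x3num ≥ 0` for `K ≥ 2`. -/
theorem x3num_nonneg_B {K f : ℕ} (hK : 2 ≤ K) : 0 ≤ x3num K f := by
  obtain ⟨k', rfl⟩ := Nat.exists_eq_add_of_le hK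
  simp only [x3num]; push_cast; ring_nf; positivity

/-- `x3num ≤ x3den` for `K ≥ 1`, `f ≥ 2`. -/
theorem x3num_le_x3den_A {K f : ℕ} (hK : 1 ≤ K) (hf : 2 ≤ f) : x3num K f ≤ x3den K f := by
  obtain ⟨k', rfl⟩ := Nat.exists_eq_add_of_le hK
  obtain ⟨f', rfl⟩ := Nat.exists_eq_add_of_le hf
  rw [← sub_nonneg]
  simp only [x3den, x3num, P33, cols1, n33]; push_cast; ring_nf; positivity

/-- `x3num ≤ x3den` for `K ≥ 2`, `f ≥ 1`. -/
theorem x3num_le_x3den_B {K f : ℕ} (hK : 2 ≤ K) (hf : 1 ≤ f) : x3num K f ≤ x3den K f := by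
  obtain ⟨k', rfl⟩ := Nat.exists_eq_add_of_le hK
  obtain ⟨f', rfl⟩ := Nat.exists_eq_add_of_le hf
  rw [← sub_nonneg]
  simp only [x3den, x3num, P33, cols1, n33]; push_cast; ring_nf; positivity

/-- `x3num ≤ x3den` for `K ≥ 3`. -/
theorem x3num_le_x3den_C {K f : ℕ} (hK : 3 ≤ K) : x3num K f ≤ x3den K f := by
  obtain ⟨k', rfl⟩ := Nat.exists_eq_add_of_le hK
  rw [← sub_nonneg]
  simp only [x3den, x3num, P33, cols1, n33]; push_cast; ring_nf; positivity

/-! ### `y₁ = β₁(1)` at level `1` (the stage's own count `K ≥ 1`, the top count `K + 1`) -/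

/-- `y1num ≥ 0` at the top count `K + 1` for `K ≥ 1`. -/
theorem y1num_nonneg {K f : ℕ} (hK : 1 ≤ K) : 0 ≤ y1num ((K : ℚ) + 1) f := by
  obtain ⟨k', rfl⟩ := Nat.exists_eq_add_of_le hK
  simp only [y1num]; push_cast; ring_nf; positivity

/-- `y1den ≥ 0` at the top count `K + 1` for `K ≥ 1`. -/
theorem y1den_nonneg {K f : ℕ} (hK : 1 ≤ K) : 0 ≤ y1den ((K : ℚ) + 1) f := by
  obtain ⟨k', rfl⟩ := Nat.exists_eq_add_of_le hK
  simp only [y1den, anum]; push_cast; ring_nf; positivity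

/-- `y1num ≤ y1den` at the top count `K + 1` for `K ≥ 1`. -/
theorem y1num_le_y1den {K f : ℕ} (hK : 1 ≤ K) : y1num ((K : ℚ) + 1) f ≤ y1den ((K : ℚ) + 1) f := by
  obtain ⟨k', rfl⟩ := Nat.exists_eq_add_of_le hK
  rw [← sub_nonneg]
  simp only [y1den, y1num, anum]; push_cast; ring_nf; positivity

end PercRepro.PuncturedLYM.Split.Peel.Cap33
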